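import Literature.Topology.FourManifolds.HandlebodyKernelExtensionGenusOne
import HarnessLib

/-!
# `TorusMappingClassFaithful` is equivalent to its model form on the Heegaard torus `∂V`

Topic `Literature/Topology/FourManifolds`; sixth file on the named fact
`Literature.Topology.FourManifolds.GriffithsExtension` (`HandlebodyKernelExtension.lean`), companion of
`TorusMappingClassFaithful.lean`, where the genus-`1` clause of Griffiths' handlebody extension
theorem is derived from the named fact `TorusMappingClassFaithful` (B. Farb, D. Margalit, *A primer
on mapping class groups* (2012), Thm. 2.5, injectivity of `σ : Mod(T²) → SL(2, ℤ)`; D. B. A. Epstein,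
*Curves on 2-manifolds and isotopies*, Acta Math. 115 (1966), Thm. 6.4).  **Everything here is
proved; no definition and no named fact is introduced; the fact is NOT discharged.**

The fact is stated over every genus-`1` handlebody `H`, every boundary datum `b` and every base
point `z`; its only consumer (`griffithsExtension_genus_one`) uses it at ONE base point of ONE torus,
the boundary `∂V` of the round solid torus `V = RoundSolidTorus ⊂ ℝ³` at `z₀ = basePt`
(`TorusMappingClassFaithful.roundSolidTorus`).  This file proves the converse reduction, so that a
future discharge may work in that single model, where the tree has coordinates
(`DehnNielsenBaerTorus.lean`: longitude/meridian angles, linear torus maps):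

* `Diffeomorph.IsDiffeotopicToId.transfer`, `….transfer'` — **transport of "diffeotopic to the
  identity" along a diffeomorphism `N ≅ N'` of possibly different manifolds** (conjugate the
  stages; Hirsch (1976), Ch. 8 §1); the same-manifold case is the tree's `Diffeotopy.pushforward` /
  `IsDiffeotopicToId.conj` (`DiffeotopyTransport.lean`);
* `forall_isDiffeotopicToId_of_roundSolidTorus` — **the model form implies the fact** (body of
  the fact spelled out; the named form is appended once `TorusMappingClassFaithful.lean` is built): given a
  genus-`1` handlebody `H` with boundary datum `b` and a based `π₁`-trivial `φ ∈ Diff(b.carrier)`,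
  identify `b.carrier ≅ ∂V` by the restriction of a diffeomorphism `H ≅ V` (uniqueness of genus-`1`
  handlebodies, `IsHandlebody.nonempty_diffeomorph_of_oneHandle`), move the base point to `z₀` by
  a diffeomorphism diffeotopic to the identity (homogeneity,
  `Diffeomorph.exists_isDiffeotopicToId_apply_eq_euclidean`, Hirsch Ch. 8 §3 Thm. 3.1), observe
  that the conjugate `τ` is again based `π₁`-trivial (functoriality of `π₁`), apply the model
  hypothesis, and transport the diffeotopy back;
* §3 the **minimal genus-one interface (E)** — "every based `π₁`-trivial self-diffeomorphism of
  `∂V` EXTENDS over `V`" (weaker than the model form of the fact by collar absorption,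
  `RoundSolidTorusModel.forall_diffeoExtends_of_faithful`): Griffiths' criterion on `V` follows
  from (E) alone (`RoundSolidTorusModel.diffeoExtends_of_map_ker_eq_ker_of_forall_diffeoExtends`,
  the proof of `HandlebodyKernelExtensionGenusOne.lean` §3 rerun with (E) in place of (F)),
  whence `griffithsExtension_genus_one_of_forall_diffeoExtends` and
  `griffithsExtension_of_forall_diffeoExtends_of_flower`.  (E) is the genus-`1` clause of the fact
  at the Torelli point; an argument giving `τ ≃ T_μⁿ` (a meridional twist power, which extends)
  proves it without pinning `n = 0`.

## References

* B. Farb, D. Margalit, *A primer on mapping class groups*, PMS 49 (2012), Thm. 2.5, Thm. 1.13.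
  [FarbMargalit2012]
* M. W. Hirsch, *Differential Topology* (1976), Ch. 8 §1 (diffeotopies), §3 Thm. 3.1
  (homogeneity). [HirschDT1976]
* A. Hatcher, *Algebraic Topology* (2002), §1.1 p. 34 (functoriality of `π₁`). [HatcherAT2002]
-/

noncomputable section

namespace Literature.Topology.FourManifolds

open Set Function
open scoped _root_.Manifold _root_.ContDiff _root_.Topology

/-! ### §1 Transport of diffeotopies along a diffeomorphism between two manifolds -/

namespace Diffeomorph

variable {EN HN : Type*} [NormedAddCommGroup EN] [NormedSpace ℝ EN] [TopologicalSpace HN]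
  {J : ModelWithCorners ℝ EN HN} {N : Type*} [TopologicalSpace N] [ChartedSpace HN N]
  {EN' HN' : Type*} [NormedAddCommGroup EN'] [NormedSpace ℝ EN'] [TopologicalSpace HN']
  {J' : ModelWithCorners ℝ EN' HN'} {N' : Type*} [TopologicalSpace N'] [ChartedSpace HN' N']

/-- **Being diffeotopic to the identity is transported by diffeomorphisms between manifolds**:
if `φ ∈ Diff(N)` is diffeotopic to the identity and `h : N ≅ N'`, then so is
`h⁻¹ ≫ φ ≫ h ∈ Diff(N')` — transport the diffeotopy `t ↦ h ∘ F_t ∘ h⁻¹` (conjugate the track by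
`id × h`; Hirsch, *Differential Topology* (1976), Ch. 8 §1).  The case `N' = N` is the tree's
`IsDiffeotopicToId.conj` / `Diffeotopy.pushforward` (`DiffeotopyTransport.lean`); the diffeotopy
is assembled by `Diffeotopy.mk'` from the two jointly smooth conjugated families.
[cite: HirschDT1976, Ch. 8 §1, p. 178] -/
theorem IsDiffeotopicToId.transfer {φ : N ≃ₘ⟮J, J⟯ N} (hφ : IsDiffeotopicToId φ)
    (h : N ≃ₘ⟮J, J'⟯ N') : IsDiffeotopicToId (h.symm.trans (φ.trans h)) := by
  obtain ⟨D, rfl⟩ := hφ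
  have h1 : ContMDiff (𝓘(ℝ, ℝ).prod J') (𝓘(ℝ, ℝ).prod J) ∞ (fun p : ℝ × N' => (p.1, h.symm p.2)) :=
    contMDiff_fst.prodMk (h.symm.contMDiff.comp contMDiff_snd)
  refine ⟨Diffeotopy.mk' J' (fun t x => h (D.toFun t (h.symm x))) (fun t y => h (D.invFun t (h.symm y)))
    (h.contMDiff.comp (D.contMDiff_uncurry_toFun.comp h1))
    (h.contMDiff.comp (D.contMDiff_uncurry_invFun.comp h1))
    (fun t x => by simp) (fun t y => by simp) (by funext x; simp), ?_⟩
  exact Diffeomorph.ext fun _ => rfl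

/-- Transport in the other direction: `h ≫ ψ ≫ h⁻¹ ∈ Diff(N)` is diffeotopic to the identity if
`ψ ∈ Diff(N')` is. [cite: HirschDT1976, Ch. 8 §1, p. 178] -/
theorem IsDiffeotopicToId.transfer' {ψ : N' ≃ₘ⟮J', J'⟯ N'} (hψ : IsDiffeotopicToId ψ)
    (h : N ≃ₘ⟮J, J'⟯ N') : IsDiffeotopicToId (h.trans (ψ.trans h.symm)) := by
  have e : h.trans (ψ.trans h.symm) = h.symm.symm.trans (ψ.trans h.symm) :=
    Diffeomorph.ext fun _ => rfl
  rw [e]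
  exact hψ.transfer h.symm

end Diffeomorph

/-! ### §2 The named fact from its model form on `∂V` -/

open RoundSolidTorusModel in
/-- **`TorusMappingClassFaithful` from its model form** (stated with the body of the named fact
spelled out, so that this file does not depend on `TorusMappingClassFaithful.lean`; the one-line
translation is appended once that module is built on the farm).  Suppose that every
self-diffeomorphism `τ` of the Heegaard torus `∂V` of the round solid torus fixing `z₀ = basePt` and
inducing the identity of `π₁(∂V, z₀)` is diffeotopic to the identity (hypothesis (F) of
`HandlebodyKernelExtensionGenusOne.lean`).  Then the same holds for every genus-`1` handlebody
`H`, every boundary datum `b` and every base point `z`: with `Θ : H ≅ V` (uniqueness of genus-`1`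
handlebodies), `θ = ∂Θ : b.carrier ≅ ∂V` and `P ∈ Diff(∂V)` diffeotopic to the identity with
`P (θ z) = z₀` (homogeneity), the conjugate `τ = e ∘ φ ∘ e⁻¹`, `e = P ∘ θ`, fixes `z₀` and is
`π₁`-trivial there (functoriality), hence diffeotopic to the identity, and `φ = e⁻¹ ∘ τ ∘ e` is
so by transport (§1).  Farb–Margalit (2012), Thm. 2.5 with Thm. 1.13; Hirsch (1976), Ch. 8 §3
Thm. 3.1.
[cite: FarbMargalit2012, Thm. 2.5 (injectivity)] [cite: HirschDT1976, Ch. 8 §3, Thm. 3.1] -/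
theorem forall_isDiffeotopicToId_of_roundSolidTorus
    (hF : ∀ (τ : (𝓡∂ 3).boundary RoundSolidTorus ≃ₘ⟮𝓡 2, 𝓡 2⟯ (𝓡∂ 3).boundary RoundSolidTorus)
      (hτ : τ basePt = basePt),
      (∀ γ, FundamentalGroup.mapOfEq (⟨τ, τ.continuous⟩ : C(_, _)) hτ γ = γ) →
        Diffeomorph.IsDiffeotopicToId τ)
    (H : Type) [TopologicalSpace H] [T2Space H] [SecondCountableTopology H]
    [ChartedSpace (EuclideanHalfSpace 3) H] [IsManifold (𝓡∂ 3) ∞ H] (hH : IsHandlebody 1 H)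
    (b : BoundaryData (𝓡∂ 3) H (𝓡 2)) (φ : b.carrier ≃ₘ⟮𝓡 2, 𝓡 2⟯ b.carrier) (z : b.carrier)
    (hz : φ z = z)
    (hφ : ∀ γ : FundamentalGroup b.carrier z,
      FundamentalGroup.mapOfEq (⟨φ, φ.continuous⟩ : C(b.carrier, b.carrier)) hz γ = γ) :
    Diffeomorph.IsDiffeotopicToId φ := by
  -- identify `b.carrier` with `∂V`
  obtain ⟨Θ⟩ := IsHandlebody.nonempty_diffeomorph_of_oneHandle oneHandle_nonempty_diffeomorph_holds
    1 H RoundSolidTorus hH isHandlebody_one_roundSolidTorus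
  set θ := b.restrictDiffeomorph (BoundaryManifold.boundaryData 2 RoundSolidTorus) Θ with hθ
  haveI : ConnectedSpace ((𝓡∂ 3).boundary RoundSolidTorus) :=
    IsHandlebody.connectedSpace_boundary_holds 1 RoundSolidTorus isHandlebody_one_roundSolidTorus
      (BoundaryManifold.boundaryData 2 RoundSolidTorus)
  -- move the base point `θ z` to `z₀` by a diffeotopy
  obtain ⟨P, hP, hPz⟩ := Diffeomorph.exists_isDiffeotopicToId_apply_eq_euclidean 2
    ((𝓡∂ 3).boundary RoundSolidTorus) (θ z) basePt
  set e : b.carrier ≃ₘ⟮𝓡 2, 𝓡 2⟯ (𝓡∂ 3).boundary RoundSolidTorus := θ.trans P with he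
  have hez : e z = basePt := by
    show P (θ z) = basePt
    exact hPz
  have hesz : e.symm basePt = z := by
    rw [← hez, Diffeomorph.symm_apply_apply]
  -- the conjugate `τ = e ∘ φ ∘ e⁻¹` is based at `z₀` …
  set τ : (𝓡∂ 3).boundary RoundSolidTorus ≃ₘ⟮𝓡 2, 𝓡 2⟯ (𝓡∂ 3).boundary RoundSolidTorus :=
    e.symm.trans (φ.trans e) with hτdef
  have hτ : τ basePt = basePt := by
    show e (φ (e.symm basePt)) = basePt
    rw [hesz, hz, hez]
  -- … and `π₁`-trivial there
  have hτπ : ∀ γ, FundamentalGroup.mapOfEq (⟨τ, τ.continuous⟩ : C(_, _)) hτ γ = γ := by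
    intro γ
    set E := Homeomorph.fundamentalGroupCongr e.toHomeomorph hez with hE
    obtain ⟨δ, rfl⟩ := E.surjective γ
    have hφe : (⟨φ, φ.continuous⟩ : C(b.carrier, b.carrier)).comp
        (⟨e.symm, e.symm.continuous⟩ : C(_, b.carrier)) basePt = z := by
      rw [ContinuousMap.comp_apply]
      show φ (e.symm basePt) = z
      rw [hesz, hz]
    -- `τ_# = e_# ∘ φ_# ∘ (e⁻¹)_#`
    have step₁ : FundamentalGroup.mapOfEq (⟨τ, τ.continuous⟩ : C(_, _)) hτ (E δ) =
        FundamentalGroup.mapOfEq (⟨e, e.continuous⟩ : C(b.carrier, _)) hez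
          (FundamentalGroup.mapOfEq ((⟨φ, φ.continuous⟩ : C(b.carrier, b.carrier)).comp
            (⟨e.symm, e.symm.continuous⟩ : C(_, b.carrier))) hφe (E δ)) :=
      FundamentalGroup.mapOfEq_comp_apply
        ((⟨φ, φ.continuous⟩ : C(b.carrier, b.carrier)).comp
          (⟨e.symm, e.symm.continuous⟩ : C(_, b.carrier)))
        (⟨e, e.continuous⟩ : C(b.carrier, _)) hφe hez (E δ)
    have step₂ : FundamentalGroup.mapOfEq ((⟨φ, φ.continuous⟩ : C(b.carrier, b.carrier)).comp
          (⟨e.symm, e.symm.continuous⟩ : C(_, b.carrier))) hφe (E δ) =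
        FundamentalGroup.mapOfEq (⟨φ, φ.continuous⟩ : C(b.carrier, b.carrier)) hz
          (FundamentalGroup.mapOfEq (⟨e.symm, e.symm.continuous⟩ : C(_, b.carrier)) hesz (E δ)) :=
      FundamentalGroup.mapOfEq_comp_apply (⟨e.symm, e.symm.continuous⟩ : C(_, b.carrier))
        (⟨φ, φ.continuous⟩ : C(b.carrier, b.carrier)) hesz hz (E δ)
    -- `(e⁻¹)_# (e_# δ) = δ`
    have step₃ : FundamentalGroup.mapOfEq (⟨e.symm, e.symm.continuous⟩ : C(_, b.carrier)) hesz
        (E δ) = δ := by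
      have h := E.symm_apply_apply δ
      rw [hE, Homeomorph.fundamentalGroupCongr_symm_apply] at h
      exact h
    rw [step₁, step₂, step₃, hφ δ]
    rfl
  -- the model hypothesis, transported back along `e`
  have hτiso : Diffeomorph.IsDiffeotopicToId τ := hF τ hτ hτπ
  have hback := hτiso.transfer' e
  have hφeq : e.trans (τ.trans e.symm) = φ := Diffeomorph.ext fun x => by
    simp only [hτdef, Diffeomorph.coe_trans, Function.comp_apply, Diffeomorph.symm_apply_apply]
  rwa [hφeq] at hback

/-! ### §3 The minimal genus-one interface: based `π₁`-trivial diffeomorphisms of `∂V` extend over `V` -/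

namespace RoundSolidTorusModel

open Literature.AlgebraicTopology.FundamentalGroup

/-- **The collar makes the extension hypothesis weaker than faithfulness**: if every based
`π₁`-trivial self-diffeomorphism of `∂V` is diffeotopic to the identity (the model form of
`TorusMappingClassFaithful`), then every such diffeomorphism extends over `V` (collar absorption,
the tree's proved `BoundaryData.diffeoExtends_of_isDiffeotopicToId_holds`; Hirsch (1976), Ch. 8 §2).
[cite: HirschDT1976, Ch. 8 §2, proof of Thm. 2.3] -/
theorem forall_diffeoExtends_of_faithful
    (hF : ∀ (τ : (𝓡∂ 3).boundary RoundSolidTorus ≃ₘ⟮𝓡 2, 𝓡 2⟯ (𝓡∂ 3).boundary RoundSolidTorus)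
      (hτ : τ basePt = basePt),
      (∀ γ, FundamentalGroup.mapOfEq (⟨τ, τ.continuous⟩ : C(_, _)) hτ γ = γ) →
        Diffeomorph.IsDiffeotopicToId τ)
    (τ : (𝓡∂ 3).boundary RoundSolidTorus ≃ₘ⟮𝓡 2, 𝓡 2⟯ (𝓡∂ 3).boundary RoundSolidTorus)
    (hτ : τ basePt = basePt)
    (h : ∀ γ, FundamentalGroup.mapOfEq (⟨τ, τ.continuous⟩ : C(_, _)) hτ γ = γ) :
    (BoundaryManifold.boundaryData 2 RoundSolidTorus).DiffeoExtends τ :=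
  BoundaryData.diffeoExtends_of_isDiffeotopicToId_holds 2 RoundSolidTorus
    (BoundaryManifold.boundaryData 2 RoundSolidTorus) τ (hF τ hτ h)

/-- **Griffiths' criterion on the round solid torus from the extension of based `π₁`-trivial
diffeomorphisms** — the minimal genus-`1` interface.  Hypothesis (E): every self-diffeomorphism
`τ` of `∂V` fixing `z₀` and inducing the identity of `π₁(∂V, z₀)` EXTENDS over `V`.  Conclusion:
every self-diffeomorphism `χ` of `∂V` satisfying Griffiths' kernel condition at some base point
extends over `V`.  The proof is that of `diffeoExtends_of_map_ker_eq_ker_of_faithful`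
(`HandlebodyKernelExtensionGenusOne.lean`) with (E) in place of (F) + collar: normalise the base
point by diffeotopies (which extend), realise the kernel-preserving automorphism `ψ_#` of
`π₁(∂V, z₀) ≅ ℤ²` — a lower-triangular matrix — by an extendable linear diffeomorphism `F`
(`exists_diffeoExtends_mapOfEq_eq`), and extend the `π₁`-trivial remainder `ψ ∘ F⁻¹` by (E).
(E) is strictly what the genus-`1` clause of Griffiths' theorem needs: it is that clause at the
Torelli point, and it follows from `TorusMappingClassFaithful` (`forall_diffeoExtends_of_faithful`)
but also from any argument producing `τ ≃ T_μⁿ` (a power of the meridional twist, which extends: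
`diffeoExtends_boundaryMatrixDiffeo`) without pinning `n = 0`.
[cite: GriffithsHB1964Handlebody, main theorem (genus 1)] -/
theorem diffeoExtends_of_map_ker_eq_ker_of_forall_diffeoExtends
    (hE : ∀ (τ : (𝓡∂ 3).boundary RoundSolidTorus ≃ₘ⟮𝓡 2, 𝓡 2⟯ (𝓡∂ 3).boundary RoundSolidTorus)
      (hτ : τ basePt = basePt),
      (∀ γ, FundamentalGroup.mapOfEq (⟨τ, τ.continuous⟩ : C(_, _)) hτ γ = γ) →
        (BoundaryManifold.boundaryData 2 RoundSolidTorus).DiffeoExtends τ)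
    (χ : (𝓡∂ 3).boundary RoundSolidTorus ≃ₘ⟮𝓡 2, 𝓡 2⟯ (𝓡∂ 3).boundary RoundSolidTorus)
    (y₀ : (𝓡∂ 3).boundary RoundSolidTorus)
    (hker : ((FundamentalGroup.map bdryIncl y₀).ker).map
        (FundamentalGroup.map (⟨χ, χ.continuous⟩ : C(_, _)) y₀)
      = (FundamentalGroup.map bdryIncl ((⟨χ, χ.continuous⟩ : C(_, _)) y₀)).ker) :
    (BoundaryManifold.boundaryData 2 RoundSolidTorus).DiffeoExtends χ := by
  haveI : ConnectedSpace ((𝓡∂ 3).boundary RoundSolidTorus) :=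
    IsHandlebody.connectedSpace_boundary_holds 1 RoundSolidTorus isHandlebody_one_roundSolidTorus
      (BoundaryManifold.boundaryData 2 RoundSolidTorus)
  -- Step 1: move the base points to `z₀` by diffeotopies
  obtain ⟨P₁, hP₁, hP₁x⟩ := Diffeomorph.exists_isDiffeotopicToId_apply_eq_euclidean 2
    ((𝓡∂ 3).boundary RoundSolidTorus) basePt y₀
  obtain ⟨P₂, hP₂, hP₂x⟩ := Diffeomorph.exists_isDiffeotopicToId_apply_eq_euclidean 2
    ((𝓡∂ 3).boundary RoundSolidTorus) (χ y₀) basePt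
  have hE₁ : (BoundaryManifold.boundaryData 2 RoundSolidTorus).DiffeoExtends P₁ :=
    BoundaryData.diffeoExtends_of_isDiffeotopicToId_holds 2 RoundSolidTorus
      (BoundaryManifold.boundaryData 2 RoundSolidTorus) P₁ hP₁
  have hE₂ : (BoundaryManifold.boundaryData 2 RoundSolidTorus).DiffeoExtends P₂ :=
    BoundaryData.diffeoExtends_of_isDiffeotopicToId_holds 2 RoundSolidTorus
      (BoundaryManifold.boundaryData 2 RoundSolidTorus) P₂ hP₂
  have hψx : ((P₁.trans χ).trans P₂) basePt = basePt := by
    show P₂ (χ (P₁ basePt)) = basePt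
    rw [hP₁x, hP₂x]
  -- the kernel condition for `ψ = P₂ ∘ χ ∘ P₁` at `z₀`
  have hkχ : ((FundamentalGroup.map bdryIncl (P₁ basePt)).ker).map
        (FundamentalGroup.map (⟨χ, χ.continuous⟩ : C(_, _)) (P₁ basePt)) =
      (FundamentalGroup.map bdryIncl ((⟨χ, χ.continuous⟩ : C(_, _)) (P₁ basePt))).ker := by
    rw [hP₁x]; exact hker
  have hkψ := (BoundaryManifold.boundaryData 2 RoundSolidTorus).map_ker_trans
    ((BoundaryManifold.boundaryData 2 RoundSolidTorus).map_ker_trans (hE₁.map_ker_eq_ker basePt) hkχ)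
    (hE₂.map_ker_eq_ker ((P₁.trans χ) basePt))
  -- Step 2: the based automorphism `Θ = ψ_#` preserves the kernel; realise it by an extendable `F`
  have hΘ : ((FundamentalGroup.map bdryIncl basePt).ker).map
      (Homeomorph.fundamentalGroupCongr ((P₁.trans χ).trans P₂).toHomeomorph hψx).toMonoidHom =
      (FundamentalGroup.map bdryIncl basePt).ker := by
    have h := map_ker_mapOfEq_eq bdryIncl
      (⟨(P₁.trans χ).trans P₂, ((P₁.trans χ).trans P₂).continuous⟩ : C(_, _)) hψx hkψ
    have e : (Homeomorph.fundamentalGroupCongr ((P₁.trans χ).trans P₂).toHomeomorph hψx).toMonoidHom =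
        FundamentalGroup.mapOfEq
          (⟨(P₁.trans χ).trans P₂, ((P₁.trans χ).trans P₂).continuous⟩ : C(_, _)) hψx :=
      MonoidHom.ext fun _ => rfl
    rw [e]; exact h
  obtain ⟨F, hFx, hFext, hFΘ⟩ := exists_diffeoExtends_mapOfEq_eq _ hΘ
  -- Step 3: `τ = ψ ∘ F⁻¹` acts trivially, hence extends by (E)
  have hFsx : F.symm basePt = basePt := by
    calc F.symm basePt = F.symm (F basePt) := by rw [hFx]
      _ = basePt := F.symm_apply_apply _
  have hτx : (F.symm.trans ((P₁.trans χ).trans P₂)) basePt = basePt := by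
    show ((P₁.trans χ).trans P₂) (F.symm basePt) = basePt
    rw [hFsx, hψx]
  have hτ : ∀ γ, FundamentalGroup.mapOfEq (⟨F.symm.trans ((P₁.trans χ).trans P₂),
      (F.symm.trans ((P₁.trans χ).trans P₂)).continuous⟩ : C(_, _)) hτx γ = γ := by
    intro γ
    have e1 := mapOfEq_comp_apply (⟨F.symm, F.symm.continuous⟩ : C(_, _))
      (⟨(P₁.trans χ).trans P₂, ((P₁.trans χ).trans P₂).continuous⟩ : C(_, _)) hFsx hψx γ
    have e2 : FundamentalGroup.mapOfEq (⟨F.symm, F.symm.continuous⟩ : C(_, _)) hFsx γ =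
        (Homeomorph.fundamentalGroupCongr ((P₁.trans χ).trans P₂).toHomeomorph hψx).symm γ := by
      apply (Homeomorph.fundamentalGroupCongr ((P₁.trans χ).trans P₂).toHomeomorph hψx).injective
      rw [MulEquiv.apply_symm_apply, ← hFΘ, ← mapOfEq_comp_apply]
      exact FundamentalGroup.mapOfEq_apply_eq_self_of_forall_eq _ (fun z => F.apply_symm_apply z) γ
    refine e1.trans ?_
    rw [e2]
    exact (Homeomorph.fundamentalGroupCongr ((P₁.trans χ).trans P₂).toHomeomorph hψx).apply_symm_apply γ
  have hτext : (BoundaryManifold.boundaryData 2 RoundSolidTorus).DiffeoExtends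
      (F.symm.trans ((P₁.trans χ).trans P₂)) := hE _ hτx hτ
  -- Step 4: compose back
  have hψext : (BoundaryManifold.boundaryData 2 RoundSolidTorus).DiffeoExtends ((P₁.trans χ).trans P₂) := by
    have h := hFext.trans hτext
    have e : F.trans (F.symm.trans ((P₁.trans χ).trans P₂)) = (P₁.trans χ).trans P₂ :=
      Diffeomorph.ext fun z => by
        simp only [Diffeomorph.coe_trans, Function.comp_apply, Diffeomorph.symm_apply_apply]
    convert h using 2
    exact e.symm
  have h := (hE₁.symm.trans hψext).trans hE₂.symm
  have e : (P₁.symm.trans ((P₁.trans χ).trans P₂)).trans P₂.symm = χ := Diffeomorph.ext fun z => by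
    simp only [Diffeomorph.coe_trans, Function.comp_apply, Diffeomorph.apply_symm_apply,
      Diffeomorph.symm_apply_apply]
  convert h using 2
  exact e.symm

end RoundSolidTorusModel

open RoundSolidTorusModel in
/-- **Genus one of Griffiths' theorem from the minimal interface (E)**: granted that every based
`π₁`-trivial self-diffeomorphism of the Heegaard torus of the round solid torus extends over it,
every kernel-preserving self-diffeomorphism of ANY boundary datum of ANY genus-`1` handlebody
extends (transport along the classification of genus-`1` handlebodies,
`BoundaryData.diffeoExtends_of_forall_diffeoExtends_of_diffeomorph`).
[cite: GriffithsHB1964Handlebody, main theorem (genus 1)] -/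
theorem griffithsExtension_genus_one_of_forall_diffeoExtends
    (hE : ∀ (τ : (𝓡∂ 3).boundary RoundSolidTorus ≃ₘ⟮𝓡 2, 𝓡 2⟯ (𝓡∂ 3).boundary RoundSolidTorus)
      (hτ : τ basePt = basePt),
      (∀ γ, FundamentalGroup.mapOfEq (⟨τ, τ.continuous⟩ : C(_, _)) hτ γ = γ) →
        (BoundaryManifold.boundaryData 2 RoundSolidTorus).DiffeoExtends τ)
    (H : Type) [TopologicalSpace H] [T2Space H] [SecondCountableTopology H]
    [ChartedSpace (EuclideanHalfSpace 3) H] [IsManifold (𝓡∂ 3) ∞ H]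
    (hH : IsHandlebody 1 H) (b : BoundaryData (𝓡∂ 3) H (𝓡 2))
    (ψ : b.carrier ≃ₘ⟮𝓡 2, 𝓡 2⟯ b.carrier) (x₀ : b.carrier)
    (hker : ((FundamentalGroup.map (⟨b.incl, b.continuous_incl⟩ : C(b.carrier, H)) x₀).ker).map
        (FundamentalGroup.map (⟨ψ, ψ.continuous⟩ : C(b.carrier, b.carrier)) x₀)
      = (FundamentalGroup.map (⟨b.incl, b.continuous_incl⟩ : C(b.carrier, H))
          ((⟨ψ, ψ.continuous⟩ : C(b.carrier, b.carrier)) x₀)).ker) :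
    b.DiffeoExtends ψ := by
  obtain ⟨Θ⟩ := IsHandlebody.nonempty_diffeomorph_of_oneHandle oneHandle_nonempty_diffeomorph_holds
    1 H RoundSolidTorus hH isHandlebody_one_roundSolidTorus
  exact b.diffeoExtends_of_forall_diffeoExtends_of_diffeomorph
    (BoundaryManifold.boundaryData 2 RoundSolidTorus) Θ
    (fun χ y₀ hk => diffeoExtends_of_map_ker_eq_ker_of_forall_diffeoExtends hE χ y₀ hk) ψ x₀ hker

open RoundSolidTorusModel in
/-- **`GriffithsExtension` from the minimal genus-one interface (E) and Griffiths' criterion on the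
flower handlebodies of genus `≥ 2`** (`griffithsExtension_of_roundSolidTorus_of_flower` with its
genus-`1` hypothesis discharged by `diffeoExtends_of_map_ker_eq_ker_of_forall_diffeoExtends`).
[cite: Hensel2020HandlebodyPrimer, Cor. 5.11 and Lemma 5.10] -/
theorem griffithsExtension_of_forall_diffeoExtends_of_flower
    (hE : ∀ (τ : (𝓡∂ 3).boundary RoundSolidTorus ≃ₘ⟮𝓡 2, 𝓡 2⟯ (𝓡∂ 3).boundary RoundSolidTorus)
      (hτ : τ basePt = basePt),
      (∀ γ, FundamentalGroup.mapOfEq (⟨τ, τ.continuous⟩ : C(_, _)) hτ γ = γ) →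
        (BoundaryManifold.boundaryData 2 RoundSolidTorus).DiffeoExtends τ)
    (h₂ : ∀ (g : ℕ) (hg : 2 ≤ g)
      (χ : (BoundaryManifold.boundaryData 2 (FlowerModel.FlowerHandlebody hg)).carrier ≃ₘ⟮𝓡 2, 𝓡 2⟯
        (BoundaryManifold.boundaryData 2 (FlowerModel.FlowerHandlebody hg)).carrier)
      (y₀ : (BoundaryManifold.boundaryData 2 (FlowerModel.FlowerHandlebody hg)).carrier),
      ((FundamentalGroup.map (⟨(BoundaryManifold.boundaryData 2 (FlowerModel.FlowerHandlebody hg)).incl,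
          (BoundaryManifold.boundaryData 2 (FlowerModel.FlowerHandlebody hg)).continuous_incl⟩ :
            C((BoundaryManifold.boundaryData 2 (FlowerModel.FlowerHandlebody hg)).carrier,
              FlowerModel.FlowerHandlebody hg)) y₀).ker).map
          (FundamentalGroup.map (⟨χ, χ.continuous⟩ : C(_, _)) y₀)
        = (FundamentalGroup.map (⟨(BoundaryManifold.boundaryData 2 (FlowerModel.FlowerHandlebody hg)).incl,
            (BoundaryManifold.boundaryData 2 (FlowerModel.FlowerHandlebody hg)).continuous_incl⟩ :
              C((BoundaryManifold.boundaryData 2 (FlowerModel.FlowerHandlebody hg)).carrier,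
                FlowerModel.FlowerHandlebody hg))
            ((⟨χ, χ.continuous⟩ : C(_, _)) y₀)).ker →
      (BoundaryManifold.boundaryData 2 (FlowerModel.FlowerHandlebody hg)).DiffeoExtends χ) :
    GriffithsExtension :=
  griffithsExtension_of_roundSolidTorus_of_flower
    (fun χ y₀ hk => diffeoExtends_of_map_ker_eq_ker_of_forall_diffeoExtends hE χ y₀ hk) h₂

end Literature.Topology.FourManifolds

end
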